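import Literature.Probability.Distributions.HermiteGaussian
import HarnessLib

/-!
# Edge ratios of Hermite polynomials at the zeros of `He_{d-1}`

For the probabilists' Hermite polynomials `Heₙ` (Mathlib's `Polynomial.hermite`, viewed over `ℝ` as
`Literature.Probability.Distributions.hermiteR n`, recurrence `He_{n+1} = X·Heₙ − Heₙ'`,
`He_{n+1}' = (n+1)·Heₙ`) we record the purely algebraic identities behind the "edge ratio" form of
Turán-type sign tests at the interlacing points:

* `hermiteR_succ_succ` : the three-term recurrence `He_{n+2} = X·He_{n+1} − (n+1)·Heₙ`
  [DLMF 18.9.1 with Table 18.9.1: `A_n = 1, B_n = 0, C_n = n`];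
* `iterate_derivative_hermiteR` : `He_d^{(m)} = (d)_m · He_{d−m}` for `m ≤ d`, `(d)_m = d!/(d−m)!`
  [DLMF 18.9.26 iterated];
* `hermiteEdgeRatio d ξ m = Q_m(ξ; d)`, the explicit `ℕ`-indexed sequence
  `Q₀ = −(d−1)`, `Q₁ = 0`, `Q_{m+2} = (ξ·Q_{m+1} − Q_m)/(d − (m+1))`;
* `hermiteR_eval_sub_eq_hermiteEdgeRatio_mul` : at a zero `ξ` of `He_{d−1}` (`2 ≤ d`), for every
  `m ≤ d`, `He_{d−m}(ξ) = Q_m(ξ; d) · He_{d−2}(ξ)` (downward recurrence started at `(He_{d−1}, He_{d−2})(ξ)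
  ∝ (0, 1)`); in particular (`m = 0`) `He_d(ξ) = −(d−1)·He_{d−2}(ξ)`;
* `iterate_derivative_hermiteR_eval_eq` : hence `He_d^{(m)}(ξ) = (d)_m · Q_m(ξ; d) · He_{d−2}(ξ)` and
  `(d−1)·He_d^{(m)}(ξ) = −(d)_m · Q_m(ξ; d) · He_d(ξ)`, with `He_{d−2}(ξ) ≠ 0`, `He_d(ξ) ≠ 0`
  (consecutive Hermite polynomials have no common zero);
* the first cases `He_d‴(ξ) = −d·ξ·He_d(ξ)` and `He_d⁗(ξ) = −d·(ξ² − d + 2)·He_d(ξ)`.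

No analysis and no sign test is performed here: identities only.

## References
* [DLMF] NIST Digital Library of Mathematical Functions, §18.9: (18.9.1) with Table 18.9.1
  (`He_{n+1}(x) = x He_n(x) − n He_{n−1}(x)`), (18.9.26) (`He_n'(x) = n He_{n−1}(x)`).
* [Szego1975] G. Szegő, *Orthogonal Polynomials*, AMS Colloq. Publ. 23, Thm 3.3.2 (zeros of `p_n`
  and `p_{n+1}` separate each other; in particular they have no common zero).
-/

open Polynomial
open scoped Nat

namespace Literature.Analysis.SpecialFunctions

open Literature.Probability.Distributions (hermiteR hermiteR_zero hermiteR_succ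
  derivative_hermiteR_succ)

noncomputable section

/-! ### Recurrences over `ℝ` -/

/-- `Heₙ` over `ℝ` evaluates as Mathlib's integral Hermite polynomial: `(hermiteR n)(x) = aeval x (hermite n)`.
[cite: DLMF, 18.3 Table 18.3.1 (He_n)] -/
theorem hermiteR_eval_eq_aeval (n : ℕ) (x : ℝ) :
    (hermiteR n).eval x = aeval x (hermite n) := by
  rw [hermiteR, eval_map, aeval_def, algebraMap_int_eq]

/-- `He₁ = X` over `ℝ`. [cite: DLMF, 18.9.1 and Table 18.9.1] -/
@[simp]
theorem hermiteR_one : hermiteR 1 = X := by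
  simp [hermiteR]

/-- Three-term recurrence of the probabilists' Hermite polynomials over `ℝ`:
`He_{n+2} = X·He_{n+1} − (n+1)·Heₙ`. [cite: DLMF, 18.9.1 and Table 18.9.1] -/
theorem hermiteR_succ_succ (n : ℕ) :
    hermiteR (n + 2) = X * hermiteR (n + 1) - C ((n : ℝ) + 1) * hermiteR n := by
  rw [hermiteR_succ (n + 1), derivative_hermiteR_succ]

/-- The recurrence evaluated at a point: `He_{n+2}(x) = x·He_{n+1}(x) − (n+1)·Heₙ(x)`.
[cite: DLMF, 18.9.1 and Table 18.9.1] -/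
theorem hermiteR_eval_succ_succ (n : ℕ) (x : ℝ) :
    (hermiteR (n + 2)).eval x
      = x * (hermiteR (n + 1)).eval x - ((n : ℝ) + 1) * (hermiteR n).eval x := by
  simp [hermiteR_succ_succ]

/-- Iterated Appell property: `He_d^{(m)} = (d)_m · He_{d−m}` for `m ≤ d`, where
`(d)_m = d!/(d−m)! = Nat.descFactorial d m`. [cite: DLMF, 18.9.26] -/
theorem iterate_derivative_hermiteR (m d : ℕ) (h : m ≤ d) :
    derivative^[m] (hermiteR d) = C ((d.descFactorial m : ℕ) : ℝ) * hermiteR (d - m) := by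
  induction m with
  | zero => simp
  | succ m ih =>
    have hm : m ≤ d := Nat.le_of_succ_le h
    obtain ⟨j, hj⟩ : ∃ j, d - m = j + 1 := ⟨d - m - 1, by omega⟩
    have hj' : d - (m + 1) = j := by omega
    rw [Function.iterate_succ_apply', ih hm, derivative_mul, derivative_C, zero_mul, zero_add, hj,
      derivative_hermiteR_succ, ← mul_assoc, ← C_mul, hj', Nat.descFactorial_succ]
    congr 2
    have : ((d - m : ℕ) : ℝ) = (j : ℝ) + 1 := by rw [hj]; push_cast; ring
    push_cast
    rw [this]
    ring

/-- `He_d^{(m)}(x) = (d)_m · He_{d−m}(x)` for `m ≤ d`. [cite: DLMF, 18.9.26] -/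
theorem iterate_derivative_hermiteR_eval (m d : ℕ) (h : m ≤ d) (x : ℝ) :
    (derivative^[m] (hermiteR d)).eval x = (d.descFactorial m : ℝ) * (hermiteR (d - m)).eval x := by
  rw [iterate_derivative_hermiteR m d h, eval_mul, eval_C]

/-! ### Consecutive Hermite polynomials have no common zero -/

/-- `He_{n+1}(ξ) = 0` and `Heₙ(ξ) = 0` cannot both hold (downward induction on the three-term
recurrence to `He₀ = 1`). [cite: Szego1975, Thm 3.3.2] -/
theorem not_hermiteR_eval_succ_and_self_eq_zero (ξ : ℝ) (n : ℕ) :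
    ¬ ((hermiteR (n + 1)).eval ξ = 0 ∧ (hermiteR n).eval ξ = 0) := by
  induction n with
  | zero => simp
  | succ n ih =>
    rintro ⟨h2, h1⟩
    apply ih
    refine ⟨h1, ?_⟩
    have hrec := hermiteR_eval_succ_succ n ξ
    rw [h2, h1, mul_zero, zero_sub] at hrec
    have hn : ((n : ℝ) + 1) ≠ 0 := by positivity
    have : ((n : ℝ) + 1) * (hermiteR n).eval ξ = 0 := by linarith
    exact (mul_eq_zero.1 this).resolve_left hn

/-- At a zero of `He_{n+1}`, `Heₙ` does not vanish. [cite: Szego1975, Thm 3.3.2] -/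
theorem hermiteR_eval_ne_zero_of_eval_succ_eq_zero {ξ : ℝ} {n : ℕ}
    (h : (hermiteR (n + 1)).eval ξ = 0) : (hermiteR n).eval ξ ≠ 0 :=
  fun h0 => not_hermiteR_eval_succ_and_self_eq_zero ξ n ⟨h, h0⟩

/-- At a zero of `Heₙ`, `He_{n+1}` does not vanish. [cite: Szego1975, Thm 3.3.2] -/
theorem hermiteR_eval_succ_ne_zero_of_eval_eq_zero {ξ : ℝ} {n : ℕ}
    (h : (hermiteR n).eval ξ = 0) : (hermiteR (n + 1)).eval ξ ≠ 0 :=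
  fun h0 => not_hermiteR_eval_succ_and_self_eq_zero ξ n ⟨h0, h⟩

/-! ### The edge-ratio sequence `Q_m(ξ; d)` -/

/-- The **edge-ratio sequence** `Q_m(ξ; d)` of the Hermite polynomials: `Q₀ = −(d−1)`, `Q₁ = 0`,
`Q_{m+2} = (ξ·Q_{m+1} − Q_m)/(d − (m+1))` (the associated-Hermite numerators obtained by running the
three-term recurrence downward from `(He_{d−1}(ξ), He_{d−2}(ξ)) ∝ (0, 1)`; for `m ≤ d` the
denominators `d − (m+1)`, `m + 1 ≤ d − 1`, are nonzero). [cite: DLMF, 18.9.1 and Table 18.9.1] -/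
def hermiteEdgeRatio (d : ℕ) (ξ : ℝ) : ℕ → ℝ
  | 0 => -((d : ℝ) - 1)
  | 1 => 0
  | m + 2 => (ξ * hermiteEdgeRatio d ξ (m + 1) - hermiteEdgeRatio d ξ m) / ((d : ℝ) - (m + 1))

/-- `Q₀(ξ; d) = −(d−1)`. [cite: DLMF, 18.9.1 and Table 18.9.1] -/
@[simp]
theorem hermiteEdgeRatio_zero (d : ℕ) (ξ : ℝ) : hermiteEdgeRatio d ξ 0 = -((d : ℝ) - 1) := by
  simp [hermiteEdgeRatio]

/-- `Q₁(ξ; d) = 0`. [cite: DLMF, 18.9.1 and Table 18.9.1] -/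
@[simp]
theorem hermiteEdgeRatio_one (d : ℕ) (ξ : ℝ) : hermiteEdgeRatio d ξ 1 = 0 := by
  simp [hermiteEdgeRatio]

/-- The defining recurrence `Q_{m+2} = (ξ·Q_{m+1} − Q_m)/(d − (m+1))`.
[cite: DLMF, 18.9.1 and Table 18.9.1] -/
theorem hermiteEdgeRatio_succ_succ (d : ℕ) (ξ : ℝ) (m : ℕ) :
    hermiteEdgeRatio d ξ (m + 2)
      = (ξ * hermiteEdgeRatio d ξ (m + 1) - hermiteEdgeRatio d ξ m) / ((d : ℝ) - (m + 1)) := by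
  simp [hermiteEdgeRatio]

/-- `Q₂(ξ; d) = 1` (for `d ≠ 1`). [cite: DLMF, 18.9.1 and Table 18.9.1] -/
theorem hermiteEdgeRatio_two {d : ℕ} (hd : d ≠ 1) (ξ : ℝ) : hermiteEdgeRatio d ξ 2 = 1 := by
  have h : (d : ℝ) - 1 ≠ 0 := by
    intro h0
    apply hd
    have : (d : ℝ) = 1 := by linarith
    exact_mod_cast this
  rw [hermiteEdgeRatio_succ_succ, hermiteEdgeRatio_one, hermiteEdgeRatio_zero, mul_zero, zero_sub,
    neg_neg, Nat.cast_zero, zero_add, div_self h]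

/-- `Q₃(ξ; d) = ξ/(d−2)` (for `d ≠ 1`). [cite: DLMF, 18.9.1 and Table 18.9.1] -/
theorem hermiteEdgeRatio_three {d : ℕ} (hd : d ≠ 1) (ξ : ℝ) :
    hermiteEdgeRatio d ξ 3 = ξ / ((d : ℝ) - 2) := by
  rw [hermiteEdgeRatio_succ_succ, hermiteEdgeRatio_two hd, hermiteEdgeRatio_one]
  norm_num

/-- `Q₄(ξ; d) = (ξ² − (d−2))/((d−2)(d−3))` (for `3 ≤ d`). [cite: DLMF, 18.9.1 and Table 18.9.1] -/
theorem hermiteEdgeRatio_four {d : ℕ} (hd : 3 ≤ d) (ξ : ℝ) :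
    hermiteEdgeRatio d ξ 4 = (ξ ^ 2 - ((d : ℝ) - 2)) / (((d : ℝ) - 2) * ((d : ℝ) - 3)) := by
  have hd1 : d ≠ 1 := by omega
  have h2 : (d : ℝ) - 2 ≠ 0 := by
    have : (3 : ℝ) ≤ d := by exact_mod_cast hd
    linarith
  rw [hermiteEdgeRatio_succ_succ, hermiteEdgeRatio_three hd1, hermiteEdgeRatio_two hd1]
  norm_num
  field_simp

/-! ### The edge-ratio identities at a zero of `He_{d−1}` -/

/-- **Edge ratio lemma (a)**: at a zero `ξ` of `He_{d−1}` (`2 ≤ d`),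
`He_d(ξ) = −(d−1)·He_{d−2}(ξ)`. [cite: DLMF, 18.9.1 and Table 18.9.1] -/
theorem hermiteR_eval_eq_neg_mul_of_root {d : ℕ} (hd : 2 ≤ d) {ξ : ℝ}
    (hξ : (hermiteR (d - 1)).eval ξ = 0) :
    (hermiteR d).eval ξ = -((d : ℝ) - 1) * (hermiteR (d - 2)).eval ξ := by
  obtain ⟨k, rfl⟩ : ∃ k, d = k + 2 := ⟨d - 2, by omega⟩
  have h1 : k + 2 - 1 = k + 1 := by omega
  have h2 : k + 2 - 2 = k := by omega
  rw [h1] at hξ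
  rw [h2, hermiteR_eval_succ_succ, hξ]
  push_cast
  ring

/-- **Edge ratio lemma (b)**: at a zero `ξ` of `He_{d−1}` (`2 ≤ d`), for every `m ≤ d`,
`He_{d−m}(ξ) = Q_m(ξ; d) · He_{d−2}(ξ)`. [cite: DLMF, 18.9.1 and Table 18.9.1] -/
theorem hermiteR_eval_sub_eq_hermiteEdgeRatio_mul {d : ℕ} (hd : 2 ≤ d) {ξ : ℝ}
    (hξ : (hermiteR (d - 1)).eval ξ = 0) {m : ℕ} (hm : m ≤ d) :
    (hermiteR (d - m)).eval ξ = hermiteEdgeRatio d ξ m * (hermiteR (d - 2)).eval ξ := by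
  obtain ⟨k, rfl⟩ : ∃ k, d = k + 2 := ⟨d - 2, by omega⟩
  have hk1 : k + 2 - 1 = k + 1 := by omega
  have hk2 : k + 2 - 2 = k := by omega
  rw [hk2]
  rw [hk1] at hξ
  -- two-step induction on `m`, keeping the side condition `m ≤ k + 2` inside the statement
  induction m using Nat.twoStepInduction with
  | zero =>
    simp only [Nat.sub_zero, hermiteEdgeRatio_zero]
    rw [hermiteR_eval_succ_succ, hξ]
    push_cast
    ring
  | one =>
    rw [hk1, hξ, hermiteEdgeRatio_one, zero_mul]
  | more m ih0 ih1 =>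
    have hmk : m ≤ k := by omega
    have e0 : k + 2 - m = (k - m) + 2 := by omega
    have e1 : k + 2 - (m + 1) = (k - m) + 1 := by omega
    have e2 : k + 2 - (m + 2) = k - m := by omega
    have ih0' := ih0 (by omega)
    have ih1' := ih1 (by omega)
    rw [e0, hermiteR_eval_succ_succ] at ih0'
    rw [e1] at ih1'
    rw [e2, hermiteEdgeRatio_succ_succ]
    have hden : ((k + 2 : ℕ) : ℝ) - (m + 1) = ((k - m : ℕ) : ℝ) + 1 := by
      push_cast
      rw [Nat.cast_sub hmk]
      ring
    have hne : ((k - m : ℕ) : ℝ) + 1 ≠ 0 := by positivity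
    rw [hden]
    field_simp
    -- from the recurrence: (k-m+1)·He_{k−m}(ξ) = ξ·He_{k−m+1}(ξ) − He_{k−m+2}(ξ)
    rw [ih1'] at ih0'
    linarith

/-- **Edge ratio lemma (c)**: at a zero `ξ` of `He_{d−1}` (`2 ≤ d`), for every `m ≤ d`,
`He_d^{(m)}(ξ) = (d)_m · Q_m(ξ; d) · He_{d−2}(ξ)`. [cite: DLMF, 18.9.26] -/
theorem iterate_derivative_hermiteR_eval_eq {d : ℕ} (hd : 2 ≤ d) {ξ : ℝ}
    (hξ : (hermiteR (d - 1)).eval ξ = 0) {m : ℕ} (hm : m ≤ d) :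
    (derivative^[m] (hermiteR d)).eval ξ
      = (d.descFactorial m : ℝ) * hermiteEdgeRatio d ξ m * (hermiteR (d - 2)).eval ξ := by
  rw [iterate_derivative_hermiteR_eval m d hm, hermiteR_eval_sub_eq_hermiteEdgeRatio_mul hd hξ hm,
    mul_assoc]

/-- At a zero `ξ` of `He_{d−1}` (`2 ≤ d`): `He_{d−2}(ξ) ≠ 0`. [cite: Szego1975, Thm 3.3.2] -/
theorem hermiteR_eval_sub_two_ne_zero_of_root {d : ℕ} (hd : 2 ≤ d) {ξ : ℝ}
    (hξ : (hermiteR (d - 1)).eval ξ = 0) : (hermiteR (d - 2)).eval ξ ≠ 0 := by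
  obtain ⟨k, rfl⟩ : ∃ k, d = k + 2 := ⟨d - 2, by omega⟩
  have hk1 : k + 2 - 1 = k + 1 := by omega
  have hk2 : k + 2 - 2 = k := by omega
  rw [hk1] at hξ
  rw [hk2]
  exact hermiteR_eval_ne_zero_of_eval_succ_eq_zero hξ

/-- At a zero `ξ` of `He_{d−1}` (`2 ≤ d`): `He_d(ξ) ≠ 0`. [cite: Szego1975, Thm 3.3.2] -/
theorem hermiteR_eval_ne_zero_of_root {d : ℕ} (hd : 2 ≤ d) {ξ : ℝ}
    (hξ : (hermiteR (d - 1)).eval ξ = 0) : (hermiteR d).eval ξ ≠ 0 := by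
  rw [hermiteR_eval_eq_neg_mul_of_root hd hξ]
  refine mul_ne_zero ?_ (hermiteR_eval_sub_two_ne_zero_of_root hd hξ)
  have : (2 : ℝ) ≤ d := by exact_mod_cast hd
  have : (d : ℝ) - 1 ≠ 0 := by linarith
  exact neg_ne_zero.mpr this

/-- **Edge ratio lemma, ratio form**: at a zero `ξ` of `He_{d−1}` (`2 ≤ d`), for every `m ≤ d`,
`(d−1)·He_d^{(m)}(ξ) = −(d)_m · Q_m(ξ; d) · He_d(ξ)`, i.e. `D^m He_d/He_d (ξ) = −((d)_m/(d−1))·Q_m(ξ; d)`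
with `He_d(ξ) ≠ 0` (`hermiteR_eval_ne_zero_of_root`). [cite: DLMF, 18.9.26] -/
theorem sub_one_mul_iterate_derivative_hermiteR_eval {d : ℕ} (hd : 2 ≤ d) {ξ : ℝ}
    (hξ : (hermiteR (d - 1)).eval ξ = 0) {m : ℕ} (hm : m ≤ d) :
    ((d : ℝ) - 1) * (derivative^[m] (hermiteR d)).eval ξ
      = -((d.descFactorial m : ℝ) * hermiteEdgeRatio d ξ m) * (hermiteR d).eval ξ := by
  rw [iterate_derivative_hermiteR_eval_eq hd hξ hm, hermiteR_eval_eq_neg_mul_of_root hd hξ]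
  ring

/-- First case of the ratio form: at a zero `ξ` of `He_{d−1}` (`2 ≤ d`),
`He_d‴(ξ) = −d·ξ·He_d(ξ)`. [cite: DLMF, 18.9.26] -/
theorem iterate_derivative_three_hermiteR_eval {d : ℕ} (hd : 3 ≤ d) {ξ : ℝ}
    (hξ : (hermiteR (d - 1)).eval ξ = 0) :
    (derivative^[3] (hermiteR d)).eval ξ = -(d : ℝ) * ξ * (hermiteR d).eval ξ := by
  have hd2 : 2 ≤ d := by omega
  have hd1 : d ≠ 1 := by omega
  have h := sub_one_mul_iterate_derivative_hermiteR_eval hd2 hξ (show 3 ≤ d from hd)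
  rw [hermiteEdgeRatio_three hd1] at h
  have hc : (d.descFactorial 3 : ℝ) = d * ((d : ℝ) - 1) * ((d : ℝ) - 2) := by
    obtain ⟨k, rfl⟩ : ∃ k, d = k + 3 := ⟨d - 3, by omega⟩
    simp [Nat.descFactorial_succ]
    ring
  rw [hc] at h
  have h1 : (d : ℝ) - 1 ≠ 0 := by
    have : (3 : ℝ) ≤ d := by exact_mod_cast hd
    linarith
  have h2 : (d : ℝ) - 2 ≠ 0 := by
    have : (3 : ℝ) ≤ d := by exact_mod_cast hd
    linarith
  have key : ((d : ℝ) - 1) * ((derivative^[3] (hermiteR d)).eval ξ + (d : ℝ) * ξ * (hermiteR d).eval ξ)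
      = 0 := by
    rw [mul_add, h]
    field_simp
    ring
  have := (mul_eq_zero.1 key).resolve_left h1
  linarith

/-- Second case of the ratio form: at a zero `ξ` of `He_{d−1}` (`4 ≤ d`),
`He_d⁗(ξ) = −d·(ξ² − d + 2)·He_d(ξ)`. [cite: DLMF, 18.9.26] -/
theorem iterate_derivative_four_hermiteR_eval {d : ℕ} (hd : 4 ≤ d) {ξ : ℝ}
    (hξ : (hermiteR (d - 1)).eval ξ = 0) :
    (derivative^[4] (hermiteR d)).eval ξ
      = -(d : ℝ) * (ξ ^ 2 - d + 2) * (hermiteR d).eval ξ := by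
  have hd2 : 2 ≤ d := by omega
  have hd3 : 3 ≤ d := by omega
  have h := sub_one_mul_iterate_derivative_hermiteR_eval hd2 hξ (show 4 ≤ d from hd)
  rw [hermiteEdgeRatio_four hd3] at h
  have hc : (d.descFactorial 4 : ℝ) = d * ((d : ℝ) - 1) * ((d : ℝ) - 2) * ((d : ℝ) - 3) := by
    obtain ⟨k, rfl⟩ : ∃ k, d = k + 4 := ⟨d - 4, by omega⟩
    simp [Nat.descFactorial_succ]
    ring
  rw [hc] at h
  have hd' : (4 : ℝ) ≤ d := by exact_mod_cast hd
  have h1 : (d : ℝ) - 1 ≠ 0 := by linarith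
  have h2 : (d : ℝ) - 2 ≠ 0 := by linarith
  have h3 : (d : ℝ) - 3 ≠ 0 := by linarith
  have key : ((d : ℝ) - 1) * ((derivative^[4] (hermiteR d)).eval ξ
      + (d : ℝ) * (ξ ^ 2 - d + 2) * (hermiteR d).eval ξ) = 0 := by
    rw [mul_add, h]
    field_simp
    ring
  have := (mul_eq_zero.1 key).resolve_left h1
  linarith

end

end Literature.Analysis.SpecialFunctions
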